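import Summits.Ventures.PercRepro2.CaseOneGadgetUWOMainI
import Summits.Ventures.PercRepro2.CaseOneGadgetUWOMainII
import Summits.Ventures.PercRepro2.CaseOneGadgetUWOMainIIQ
import Summits.Ventures.PercRepro2.CaseOneGadgetUWOMainIQ
import Summits.Ventures.PercRepro2.CaseOnePendantQ
import Summits.Ventures.PercRepro2.CaseOnePendantTreeMarks
import Summits.Ventures.PercRepro2.CaseOneClosedAtIff

/-!
# The gadget `u ~ {w, o}`, `w ~ {u, a₁, a₂, b}` (uwo): the closed anchor — all four forms, `(J1₁)`, pendant trees
(blind cell PercRepro2, p1 g26; S5 §2.1 (K9): the uwo row closed on all four cells; own code, on the pattern of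
CaseOneGadgetUWA1Pendant / CaseOneGadgetUWA1Anchor with the roles of the root `a₁` and the mark `o` exchanged
between the two centres)

With the four chain heads `zSplitI_of_gadgetUWO` / `zSplitIQ_of_gadgetUWO` (the face induction in `e(w–a₁)`) and
`zSplitII_of_gadgetUWO` / `zSplitIIQ_of_gadgetUWO` (plain cone chains), a uwo-gadget vertex has **all four forms
for every finite graph and every weight vector** (`fourForms_of_gadgetUWO`), hence `(J1₁)` there
(`jOneOne_of_gadgetUWO`, K1). The pendant lemma K8 at a uwo-gadget vertex (`zSplitI/IQ/II/IIQ_of_leaf_gadgetUWO`: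
`a₃` a leaf at `u` of any weight, `u` a gadget vertex in `G − e₀`, transferred to `G` by the leaf-deletion identities
`zSplit*_of_restrict`) and the six-edge description `IsPendantGadgetUWOAt` of this class in `G` itself
(`zSplit*_of_pendantGadgetUWO`, `fourForms_of_pendantGadgetUWO`, `jOneOne_of_pendantGadgetUWO`) complete the row;
the anchor `GadgetUWOAnchor` is closed in the sense of the pendant-tree closure (`fourFormsAll_of_gadgetUWOAnchor`,
`closedAt_of_gadgetUWOAnchor`): every vertex of every pendant tree hanging at a uwo-gadget vertex has the four forms,
`(J1₁)` and — where `P(T′) > 0` — `(RV)`, and every instance reachable from a uwo-gadget vertex by the moves of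
CaseOneMoves is closed (`closedAt_of_moves_gadgetUWO`, `fourForms_of_moves_gadgetUWO`). The uwo shape is not
symmetric in the roots, so no `(J1)` is claimed. Standard axioms. -/

namespace Summit.Ventures.PercRepro2

namespace CaseOne

universe u

section Vertex
variable {V : Type*} {E : Type*} [Fintype E] [DecidableEq E] [Fintype V] [DecidableEq V]
  {R : Type*} [Field R] [LinearOrder R] [IsStrictOrderedRing R]
variable {ends : E → Sym2 V} {o a₁ a₂ b u w : V} {euw euo ewa1 ewa2 ewb : E}

/-- **All four forms at a uwo-gadget vertex**, every finite graph, every weight vector. -/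
theorem fourForms_of_gadgetUWO (p : E → R) (hp : IsProbVec p)
    (h : IsGadgetUWO ends o a₁ a₂ b u w euw euo ewa1 ewa2 ewb) : FourForms p ends o a₁ a₂ u b :=
  ⟨zSplitII_of_gadgetUWO p hp h, zSplitIIQ_of_gadgetUWO p hp h, zSplitI_of_gadgetUWO p hp h,
    zSplitIQ_of_gadgetUWO p hp h⟩

/-- **`(J1₁)` at a uwo-gadget vertex** (K1: `(i)` and `(ii)` give `(J1₁)`). -/
theorem jOneOne_of_gadgetUWO (p : E → R) (hp : IsProbVec p)
    (h : IsGadgetUWO ends o a₁ a₂ b u w euw euo ewa1 ewa2 ewb) : JOneOne p ends o a₁ a₂ u b :=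
  jOneOne_of_i_of_ii p ends o a₁ a₂ u b (zSplitI_of_gadgetUWO p hp h) (zSplitII_of_gadgetUWO p hp h)

end Vertex

section Pendant
variable {V : Type*} {E : Type*} [Fintype E] [DecidableEq E] [Fintype V] [DecidableEq V]
  {R : Type*} [Field R] [LinearOrder R] [IsStrictOrderedRing R]
variable {ends : E → Sym2 V} {o a₁ a₂ b u w a₃ : V} {e₀ : E}

/-- **`(i)` for `a₃` pendant at a uwo-gadget vertex**: `a₃` is a leaf at `u` (edge `e₀`), and in `G − e₀` the
vertex `u` is a uwo-gadget vertex; every weight vector (the weight of `e₀` included). -/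
theorem zSplitI_of_leaf_gadgetUWO (p : E → R) (hp : IsProbVec p) (hl : IsLeafAt ends u a₃ e₀)
    (ho : o ≠ a₃) (h1 : a₁ ≠ a₃) (h2 : a₂ ≠ a₃) (hb : b ≠ a₃)
    {euw euo ewa1 ewa2 ewb : {e : E // e ≠ e₀}}
    (h : IsGadgetUWO (restrictEnds ends e₀) o a₁ a₂ b u w euw euo ewa1 ewa2 ewb) :
    ZSplitI p ends o a₁ a₂ a₃ b :=
  zSplitI_of_leaf_at p hp hl o a₁ a₂ b ho h1 h2 hb
    (zSplitI_of_restrict p hl ho h1 h2 hl.ne hb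
      (zSplitI_of_gadgetUWO (restrictW p e₀) (IsProbVec.restrictW hp e₀) h))
    (zSplitIQ_of_restrict p hl ho h1 h2 hl.ne hb
      (zSplitIQ_of_gadgetUWO (restrictW p e₀) (IsProbVec.restrictW hp e₀) h))

/-- **`(i-Q)` for `a₃` pendant at a uwo-gadget vertex**: the Q-threshold form scales down the leaf edge. -/
theorem zSplitIQ_of_leaf_gadgetUWO (p : E → R) (hp : IsProbVec p) (hl : IsLeafAt ends u a₃ e₀)
    (ho : o ≠ a₃) (h1 : a₁ ≠ a₃) (h2 : a₂ ≠ a₃) (hb : b ≠ a₃)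
    {euw euo ewa1 ewa2 ewb : {e : E // e ≠ e₀}}
    (h : IsGadgetUWO (restrictEnds ends e₀) o a₁ a₂ b u w euw euo ewa1 ewa2 ewb) :
    ZSplitIQ p ends o a₁ a₂ a₃ b :=
  zSplitIQ_of_leaf_at p hp hl o a₁ a₂ b ho h1 h2 hb
    (zSplitIQ_of_restrict p hl ho h1 h2 hl.ne hb
      (zSplitIQ_of_gadgetUWO (restrictW p e₀) (IsProbVec.restrictW hp e₀) h))

/-- **`(ii)` for `a₃` pendant at a uwo-gadget vertex.** -/
theorem zSplitII_of_leaf_gadgetUWO (p : E → R) (hp : IsProbVec p) (hl : IsLeafAt ends u a₃ e₀)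
    (ho : o ≠ a₃) (h1 : a₁ ≠ a₃) (h2 : a₂ ≠ a₃) (hb : b ≠ a₃)
    {euw euo ewa1 ewa2 ewb : {e : E // e ≠ e₀}}
    (h : IsGadgetUWO (restrictEnds ends e₀) o a₁ a₂ b u w euw euo ewa1 ewa2 ewb) :
    ZSplitII p ends o a₁ a₂ a₃ b :=
  zSplitII_of_leaf_at p hp hl o a₁ a₂ b ho h1 h2 hb
    (zSplitII_of_restrict p hl ho h1 h2 hl.ne hb
      (zSplitII_of_gadgetUWO (restrictW p e₀) (IsProbVec.restrictW hp e₀) h))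
    (zSplitIIQ_of_restrict p hl ho h1 h2 hl.ne hb
      (zSplitIIQ_of_gadgetUWO (restrictW p e₀) (IsProbVec.restrictW hp e₀) h))

/-- **`(ii-Q)` for `a₃` pendant at a uwo-gadget vertex.** -/
theorem zSplitIIQ_of_leaf_gadgetUWO (p : E → R) (hp : IsProbVec p) (hl : IsLeafAt ends u a₃ e₀)
    (ho : o ≠ a₃) (h1 : a₁ ≠ a₃) (h2 : a₂ ≠ a₃) (hb : b ≠ a₃)
    {euw euo ewa1 ewa2 ewb : {e : E // e ≠ e₀}}
    (h : IsGadgetUWO (restrictEnds ends e₀) o a₁ a₂ b u w euw euo ewa1 ewa2 ewb) :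
    ZSplitIIQ p ends o a₁ a₂ a₃ b :=
  zSplitIIQ_of_leaf_at p hp hl o a₁ a₂ b ho h1 h2 hb
    (zSplitIIQ_of_restrict p hl ho h1 h2 hl.ne hb
      (zSplitIIQ_of_gadgetUWO (restrictW p e₀) (IsProbVec.restrictW hp e₀) h))

/-- **`(J1₁)` for `a₃` pendant at a uwo-gadget vertex.** -/
theorem jOneOne_of_leaf_gadgetUWO (p : E → R) (hp : IsProbVec p) (hl : IsLeafAt ends u a₃ e₀)
    (ho : o ≠ a₃) (h1 : a₁ ≠ a₃) (h2 : a₂ ≠ a₃) (hb : b ≠ a₃)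
    {euw euo ewa1 ewa2 ewb : {e : E // e ≠ e₀}}
    (h : IsGadgetUWO (restrictEnds ends e₀) o a₁ a₂ b u w euw euo ewa1 ewa2 ewb) :
    JOneOne p ends o a₁ a₂ a₃ b :=
  jOneOne_of_i_of_ii p ends o a₁ a₂ a₃ b (zSplitI_of_leaf_gadgetUWO p hp hl ho h1 h2 hb h)
    (zSplitII_of_leaf_gadgetUWO p hp hl ho h1 h2 hb h)

end Pendant

section SixEdges
variable {V : Type*} {E : Type*}

/-- **The pendant uwo gadget**: `a₃` is a leaf at `u` through `e₀`, the other edges at `u` are exactly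
`euw = {w, u}` and `euo = {o, u}`, and the edges at `w` are exactly `euw`, `ewa1 = {a₁, w}`, `ewa2 = {a₂, w}`,
`ewb = {b, w}` (five distinct edges), with the vertex inequalities of `IsGadgetUWO` and `a₁, a₂, o, b, w ≠ a₃`. -/
structure IsPendantGadgetUWOAt (ends : E → Sym2 V) (o a₁ a₂ b u w a₃ : V)
    (e₀ euw euo ewa1 ewa2 ewb : E) : Prop where
  /-- the leaf -/
  leaf : IsLeafAt ends u a₃ e₀
  /-- the edge `{w, u}` -/
  ends_uw : ends euw = s(w, u)
  /-- the edge `{o, u}` -/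
  ends_uo : ends euo = s(o, u)
  /-- the edge `{a₁, w}` -/
  ends_wa1 : ends ewa1 = s(a₁, w)
  /-- the edge `{a₂, w}` -/
  ends_wa2 : ends ewa2 = s(a₂, w)
  /-- the edge `{b, w}` -/
  ends_wb : ends ewb = s(b, w)
  /-- distinct edges -/
  ne_uw_uo : euw ≠ euo
  /-- distinct edges -/
  ne_uw_wa1 : euw ≠ ewa1
  /-- distinct edges -/
  ne_uw_wa2 : euw ≠ ewa2
  /-- distinct edges -/
  ne_uw_wb : euw ≠ ewb
  /-- distinct edges -/
  ne_uo_wa1 : euo ≠ ewa1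
  /-- distinct edges -/
  ne_uo_wa2 : euo ≠ ewa2
  /-- distinct edges -/
  ne_uo_wb : euo ≠ ewb
  /-- distinct edges -/
  ne_wa1_wa2 : ewa1 ≠ ewa2
  /-- distinct edges -/
  ne_wa1_wb : ewa1 ≠ ewb
  /-- distinct edges -/
  ne_wa2_wb : ewa2 ≠ ewb
  /-- no other edge at `u` -/
  unique_u : ∀ e, u ∈ ends e → e = e₀ ∨ e = euw ∨ e = euo
  /-- no other edge at `w` -/
  unique_w : ∀ e, w ∈ ends e → e = euw ∨ e = ewa1 ∨ e = ewa2 ∨ e = ewb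
  /-- `w ≠ u` -/
  ne_wu : w ≠ u
  /-- `o ≠ u` -/
  ne_ou : o ≠ u
  /-- `b ≠ u` -/
  ne_bu : b ≠ u
  /-- `a₁ ≠ u` -/
  ne_a1u : a₁ ≠ u
  /-- `a₂ ≠ u` -/
  ne_a2u : a₂ ≠ u
  /-- `a₁ ≠ w` -/
  ne_a1w : a₁ ≠ w
  /-- `a₂ ≠ w` -/
  ne_a2w : a₂ ≠ w
  /-- `o ≠ w` -/
  ne_ow : o ≠ w
  /-- `b ≠ w` -/
  ne_bw : b ≠ w
  /-- `a₁ ≠ a₃` -/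
  ne_a1' : a₁ ≠ a₃
  /-- `a₂ ≠ a₃` -/
  ne_a2' : a₂ ≠ a₃
  /-- `o ≠ a₃` -/
  ne_o' : o ≠ a₃
  /-- `b ≠ a₃` -/
  ne_b' : b ≠ a₃
  /-- `w ≠ a₃` -/
  ne_w' : w ≠ a₃

variable {ends : E → Sym2 V} {o a₁ a₂ b u w a₃ : V} {e₀ euw euo ewa1 ewa2 ewb : E}

/-- In `G − e₀` the vertex `u` of a pendant uwo gadget is a uwo-gadget vertex. -/
theorem IsPendantGadgetUWOAt.gadgetUWO
    (h : IsPendantGadgetUWOAt ends o a₁ a₂ b u w a₃ e₀ euw euo ewa1 ewa2 ewb) :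
    IsGadgetUWO (restrictEnds ends e₀) o a₁ a₂ b u w
      ⟨euw, ne_leaf_edge_of_ends h.leaf h.ends_uw h.ne_w'⟩
      ⟨euo, ne_leaf_edge_of_ends h.leaf h.ends_uo h.ne_o'⟩
      ⟨ewa1, ne_leaf_edge_of_ends' h.leaf h.ends_wa1 h.ne_a1u h.ne_wu⟩
      ⟨ewa2, ne_leaf_edge_of_ends' h.leaf h.ends_wa2 h.ne_a2u h.ne_wu⟩
      ⟨ewb, ne_leaf_edge_of_ends' h.leaf h.ends_wb h.ne_bu h.ne_wu⟩ where
  ends_uw := h.ends_uw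
  ends_uo := h.ends_uo
  ends_wa1 := h.ends_wa1
  ends_wa2 := h.ends_wa2
  ends_wb := h.ends_wb
  ne_uw_uo := fun h' => h.ne_uw_uo (congrArg Subtype.val h')
  ne_uw_wa1 := fun h' => h.ne_uw_wa1 (congrArg Subtype.val h')
  ne_uw_wa2 := fun h' => h.ne_uw_wa2 (congrArg Subtype.val h')
  ne_uw_wb := fun h' => h.ne_uw_wb (congrArg Subtype.val h')
  ne_uo_wa1 := fun h' => h.ne_uo_wa1 (congrArg Subtype.val h')
  ne_uo_wa2 := fun h' => h.ne_uo_wa2 (congrArg Subtype.val h')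
  ne_uo_wb := fun h' => h.ne_uo_wb (congrArg Subtype.val h')
  ne_wa1_wa2 := fun h' => h.ne_wa1_wa2 (congrArg Subtype.val h')
  ne_wa1_wb := fun h' => h.ne_wa1_wb (congrArg Subtype.val h')
  ne_wa2_wb := fun h' => h.ne_wa2_wb (congrArg Subtype.val h')
  unique_u := by
    rintro ⟨e, he0⟩ hu
    rcases h.unique_u e hu with rfl | rfl | rfl
    · exact absurd rfl he0
    · exact Or.inl rfl
    · exact Or.inr rfl
  unique_w := by
    rintro ⟨e, _⟩ hw
    rcases h.unique_w e hw with rfl | rfl | rfl | rfl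
    · exact Or.inl rfl
    · exact Or.inr (Or.inl rfl)
    · exact Or.inr (Or.inr (Or.inl rfl))
    · exact Or.inr (Or.inr (Or.inr rfl))
  ne_wu := h.ne_wu
  ne_ou := h.ne_ou
  ne_bu := h.ne_bu
  ne_a1u := h.ne_a1u
  ne_a2u := h.ne_a2u
  ne_a1w := h.ne_a1w
  ne_a2w := h.ne_a2w
  ne_ow := h.ne_ow
  ne_bw := h.ne_bw

end SixEdges

section PendantSix
variable {V : Type*} {E : Type*} [Fintype E] [DecidableEq E] [Fintype V] [DecidableEq V]
  {R : Type*} [Field R] [LinearOrder R] [IsStrictOrderedRing R]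
variable {ends : E → Sym2 V} {o a₁ a₂ b u w a₃ : V} {e₀ euw euo ewa1 ewa2 ewb : E}

/-- **`(i)` for the pendant uwo gadget in `G`**: `a₃` a leaf at `u`, `u` adjacent to `a₃, w, o` and nothing else,
`w` adjacent to `u, a₁, a₂, b` and nothing else; every finite graph, every weight vector. -/
theorem zSplitI_of_pendantGadgetUWO (p : E → R) (hp : IsProbVec p)
    (h : IsPendantGadgetUWOAt ends o a₁ a₂ b u w a₃ e₀ euw euo ewa1 ewa2 ewb) :
    ZSplitI p ends o a₁ a₂ a₃ b :=
  zSplitI_of_leaf_gadgetUWO p hp h.leaf h.ne_o' h.ne_a1' h.ne_a2' h.ne_b' h.gadgetUWO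

/-- **`(i-Q)` for the pendant uwo gadget in `G`.** -/
theorem zSplitIQ_of_pendantGadgetUWO (p : E → R) (hp : IsProbVec p)
    (h : IsPendantGadgetUWOAt ends o a₁ a₂ b u w a₃ e₀ euw euo ewa1 ewa2 ewb) :
    ZSplitIQ p ends o a₁ a₂ a₃ b :=
  zSplitIQ_of_leaf_gadgetUWO p hp h.leaf h.ne_o' h.ne_a1' h.ne_a2' h.ne_b' h.gadgetUWO

/-- **`(ii)` for the pendant uwo gadget in `G`.** -/
theorem zSplitII_of_pendantGadgetUWO (p : E → R) (hp : IsProbVec p)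
    (h : IsPendantGadgetUWOAt ends o a₁ a₂ b u w a₃ e₀ euw euo ewa1 ewa2 ewb) :
    ZSplitII p ends o a₁ a₂ a₃ b :=
  zSplitII_of_leaf_gadgetUWO p hp h.leaf h.ne_o' h.ne_a1' h.ne_a2' h.ne_b' h.gadgetUWO

/-- **`(ii-Q)` for the pendant uwo gadget in `G`.** -/
theorem zSplitIIQ_of_pendantGadgetUWO (p : E → R) (hp : IsProbVec p)
    (h : IsPendantGadgetUWOAt ends o a₁ a₂ b u w a₃ e₀ euw euo ewa1 ewa2 ewb) :
    ZSplitIIQ p ends o a₁ a₂ a₃ b :=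
  zSplitIIQ_of_leaf_gadgetUWO p hp h.leaf h.ne_o' h.ne_a1' h.ne_a2' h.ne_b' h.gadgetUWO

/-- **All four forms for the pendant uwo gadget in `G`.** -/
theorem fourForms_of_pendantGadgetUWO (p : E → R) (hp : IsProbVec p)
    (h : IsPendantGadgetUWOAt ends o a₁ a₂ b u w a₃ e₀ euw euo ewa1 ewa2 ewb) :
    FourForms p ends o a₁ a₂ a₃ b :=
  ⟨zSplitII_of_pendantGadgetUWO p hp h, zSplitIIQ_of_pendantGadgetUWO p hp h,
    zSplitI_of_pendantGadgetUWO p hp h, zSplitIQ_of_pendantGadgetUWO p hp h⟩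

/-- **`(J1₁)` for the pendant uwo gadget in `G`.** -/
theorem jOneOne_of_pendantGadgetUWO (p : E → R) (hp : IsProbVec p)
    (h : IsPendantGadgetUWOAt ends o a₁ a₂ b u w a₃ e₀ euw euo ewa1 ewa2 ewb) :
    JOneOne p ends o a₁ a₂ a₃ b :=
  jOneOne_of_i_of_ii p ends o a₁ a₂ a₃ b (zSplitI_of_pendantGadgetUWO p hp h)
    (zSplitII_of_pendantGadgetUWO p hp h)

end PendantSix

section AnchorDef
variable {V : Type*}

/-- The uwo-gadget anchor: `v ~ {w, o}` with `w ~ {v, a₁, a₂, b}` for some unmarked `w`. -/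
def GadgetUWOAnchor (o a₁ a₂ b : V) (E : Type u) (ends : E → Sym2 V) (v : V) : Prop :=
  ∃ (w : V) (euw euo ewa1 ewa2 ewb : E), IsGadgetUWO ends o a₁ a₂ b v w euw euo ewa1 ewa2 ewb

end AnchorDef

section Anchor
variable {V : Type*} [Fintype V] [DecidableEq V] {R : Type*} [Field R] [LinearOrder R]
  [IsStrictOrderedRing R]

variable (o a₁ a₂ b : V)

/-- A uwo-gadget anchor has the four forms. -/
theorem fourForms_of_gadgetUWOAnchor (E : Type u) [Fintype E] [DecidableEq E] (ends : E → Sym2 V)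
    (p : E → R) (hp : IsProbVec p) (v : V) (h : GadgetUWOAnchor o a₁ a₂ b E ends v) :
    FourForms p ends o a₁ a₂ v b := by
  obtain ⟨w, euw, euo, ewa1, ewa2, ewb, h⟩ := h
  exact fourForms_of_gadgetUWO p hp h

/-- A uwo-gadget anchor is closed for every weight vector: `FourFormsAll`. -/
theorem fourFormsAll_of_gadgetUWOAnchor (E : Type u) [Fintype E] [DecidableEq E] (ends : E → Sym2 V)
    (v : V) (h : GadgetUWOAnchor o a₁ a₂ b E ends v) : FourFormsAll R o a₁ a₂ b E ends v := by
  intro _ _ p hp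
  exact fourForms_of_gadgetUWOAnchor o a₁ a₂ b E ends p hp v h

/-- A uwo-gadget anchor is closed: `ClosedAt`. -/
theorem closedAt_of_gadgetUWOAnchor (E : Type u) [Fintype E] [DecidableEq E] (ends : E → Sym2 V)
    (v : V) (h : GadgetUWOAnchor o a₁ a₂ b E ends v) : ClosedAt R o a₁ a₂ b E ends v :=
  fun p hp => fourForms_of_gadgetUWOAnchor o a₁ a₂ b E ends p hp v h

/-- **Every instance reachable by moves from a uwo-gadget vertex is closed.** -/
theorem closedAt_of_moves_gadgetUWO {E' : Type u} [Fintype E'] [DecidableEq E'] {ends' : E' → Sym2 V}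
    {v' : V} (h' : GadgetUWOAnchor o a₁ a₂ b E' ends' v') {E : Type u} [Fintype E] [DecidableEq E]
    {ends : E → Sym2 V} {v : V} (h : Moves o a₁ a₂ b E' ends' v' E ends v) :
    ClosedAt R o a₁ a₂ b E ends v :=
  closedAt_of_moves h (closedAt_of_gadgetUWOAnchor o a₁ a₂ b E' ends' v' h')

/-- The four forms for one weight vector on every instance reachable by moves from a uwo-gadget vertex. -/
theorem fourForms_of_moves_gadgetUWO {E' : Type u} [Fintype E'] [DecidableEq E'] {ends' : E' → Sym2 V}
    {v' : V} (h' : GadgetUWOAnchor o a₁ a₂ b E' ends' v') {E : Type u} [Fintype E] [DecidableEq E]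
    {ends : E → Sym2 V} {v : V} (h : Moves o a₁ a₂ b E' ends' v' E ends v) (p : E → R)
    (hp : IsProbVec p) : FourForms p ends o a₁ a₂ v b :=
  closedAt_of_moves_gadgetUWO o a₁ a₂ b h' h p hp

variable {E : Type u} [Fintype E] [DecidableEq E] {ends : E → Sym2 V} {v a₃ y : V} {S : Set V} {n : ℕ}

/-- **The four forms at the end of a pendant path of any length at a uwo-gadget vertex**, every finite graph,
every weight vector. -/
theorem fourForms_of_pendantPath_gadgetUWO (p : E → R) (hp : IsProbVec p)
    (h : IsPendantPathAt (GadgetUWOAnchor o a₁ a₂ b) o a₁ a₂ b n E ends v a₃) :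
    FourForms p ends o a₁ a₂ a₃ b :=
  fourForms_of_pendantPath (GadgetUWOAnchor o a₁ a₂ b) o a₁ a₂ b
    (fourForms_of_gadgetUWOAnchor o a₁ a₂ b) n E ends p hp v a₃ h

/-- **`(RV)` at the end of a pendant path of any length at a uwo-gadget vertex** (where `P(T′) > 0`). -/
theorem rv_of_pendantPath_gadgetUWO (p : E → R) (hp : IsProbVec p)
    (h : IsPendantPathAt (GadgetUWOAnchor o a₁ a₂ b) o a₁ a₂ b n E ends v a₃)
    (hT : 0 < prob p (Tp ends a₁ a₂ a₃)) : RV p ends o a₁ a₂ a₃ b :=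
  rv_of_pendantPath (GadgetUWOAnchor o a₁ a₂ b) (fourForms_of_gadgetUWOAnchor o a₁ a₂ b) p hp h hT

/-- **The four forms at every vertex of every pendant tree hanging at a uwo-gadget vertex**, every finite graph,
every weight vector. -/
theorem fourForms_of_pendantTree_gadgetUWO (p : E → R) (hp : IsProbVec p)
    (h : IsPendantTreeAt (GadgetUWOAnchor o a₁ a₂ b) o a₁ a₂ b n E ends v S) (hy : y ∈ S) :
    FourForms p ends o a₁ a₂ y b :=
  fourForms_of_pendantTree (GadgetUWOAnchor o a₁ a₂ b) o a₁ a₂ b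
    (fourForms_of_gadgetUWOAnchor o a₁ a₂ b) n E ends p hp v S h y hy

/-- **`(J1₁)` at every vertex of every pendant tree hanging at a uwo-gadget vertex.** -/
theorem jOneOne_of_pendantTree_gadgetUWO (p : E → R) (hp : IsProbVec p)
    (h : IsPendantTreeAt (GadgetUWOAnchor o a₁ a₂ b) o a₁ a₂ b n E ends v S) (hy : y ∈ S) :
    JOneOne p ends o a₁ a₂ y b :=
  jOneOne_of_i_of_ii p ends o a₁ a₂ y b (fourForms_of_pendantTree_gadgetUWO o a₁ a₂ b p hp h hy).2.2.1
    (fourForms_of_pendantTree_gadgetUWO o a₁ a₂ b p hp h hy).1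

/-- **`(RV)` at every vertex of every pendant tree hanging at a uwo-gadget vertex** (where `P(T′) > 0`). -/
theorem rv_of_pendantTree_gadgetUWO (p : E → R) (hp : IsProbVec p)
    (h : IsPendantTreeAt (GadgetUWOAnchor o a₁ a₂ b) o a₁ a₂ b n E ends v S) (hy : y ∈ S)
    (hT : 0 < prob p (Tp ends a₁ a₂ y)) : RV p ends o a₁ a₂ y b :=
  rv_of_pendantTree (GadgetUWOAnchor o a₁ a₂ b) (fourForms_of_gadgetUWOAnchor o a₁ a₂ b) p hp h hy hT

end Anchor

end CaseOne

end Summit.Ventures.PercRepro2
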